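import Literature.Probability.Process.ItoCalculusProofs
import Literature.Probability.Process.BrownianQuadraticSums
import Literature.Probability.Process.ItoFormulaPathwise
import HarnessLib

/-!
# Itô's formula in expectation for elementary integrals against Brownian motion

A second-order **Itô–Taylor expansion in expectation**, with an explicit error term, for the
elementary stochastic integral `X = H · B` of a bounded simple process `H` (`Literature.Probability.Process.SimpleProcess`)
against the canonical Brownian motion `B = Literature.brownian` on `(ℝ≥0 → ℝ, preWienerMeasure)` with
its raw natural filtration `𝓕⁰ = Literature.brownianFiltration`, along the (capped) partition
`T ∧ tᵢ` of `H` itself: for `f ∈ C²(ℝ)` with `|f''| ≤ M` and a modulus of continuity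
`|x - y| ≤ δ ⇒ |f''(x) - f''(y)| ≤ η` of `f''`,

  `|E[f(X_T)] - f(0) - ½ ∑ᵢ (Δᵢt) E[f''(X_{T ∧ tᵢ}) Hᵢ²]|`
  `≤ ∑ᵢ (η (Δᵢt) E[Hᵢ²] + (6M/δ²) (Δᵢt)² E[Hᵢ⁴])`, `Δᵢt = T ∧ tᵢ₊₁ - T ∧ tᵢ`

(`SimpleProcess.ito_taylor_estimate_brownian`). Over one cell `(a, b]`, with `Y = X_a` and
`V = Hᵢ` both `𝓕⁰_a`-measurable and `D = V (B_b - B_a)`: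
`E[f(Y + D)] - E[f(Y)] = E[f'(Y) V ΔB] + ½ E[f''(Y) V² (ΔB)²] + E[R]` where the first term
vanishes and the second equals `½ (b - a) E[f''(Y) V²]` by independence of the increment from
`𝓕⁰_a` (`E[ΔB] = 0`, `E[(ΔB)²] = b - a`), and the Taylor remainder satisfies
`|R| ≤ η D² + (2M/δ²) D⁴` pointwise (two regimes of the modulus), whence
`E|R| ≤ η (b - a) E[V²] + (6M/δ²) (b - a)² E[V⁴]` (`E[(ΔB)⁴] = 3 (b - a)²`).

This is the elementary-integrand, expectation form of Itô's formula
`E[f(X_T)] = f(0) + ½ E ∫₀ᵀ f''(X_s) H_s² ds` (Revuz–Yor, Ch. IV, Thm (3.3) with Remark 1;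
the Riemann sum replaces the time integral, with the error controlled by the mesh through the
fourth moments), proved here from first principles (independent Gaussian increments and the
deterministic Taylor estimate `Literature.Probability.Process.abs_taylor_two_sub_le`), for the raw filtration. It is the
tool by which the Yamada–Watanabe functional is evaluated along elementary approximants in the
pathwise-uniqueness and existence proofs for squared Bessel processes.

## References

* D. Revuz, M. Yor, *Continuous Martingales and Brownian Motion* (3rd ed., 1999), Ch. IV,
  Thm (3.3) and its proof (Taylor expansion along subdivisions), Remark 1 after it; Ch. IV,
  proof of Thm (1.3) (moments of Gaussian increments).
* J.-F. Le Gall, *Brownian Motion, Martingales, and Stochastic Calculus* (2016), Thm 5.10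
  (proof).
-/

open MeasureTheory ProbabilityTheory Filter Finset
open scoped NNReal ENNReal Topology

noncomputable section

namespace Literature.Probability.Process

/-! ### Calculus: growth of a `C²` function with bounded second derivative -/

section Calculus

variable {f f' f'' : ℝ → ℝ} {M : ℝ}

/-- `|x| ≤ 1 + x²`. [folklore] -/
theorem abs_le_one_add_sq (x : ℝ) : |x| ≤ 1 + x ^ 2 := by
  rcases le_or_gt |x| 1 with h | h
  · nlinarith [sq_nonneg x]
  · have : |x| ≤ |x| ^ 2 := by nlinarith
    rw [sq_abs] at this
    linarith

/-- A bound on `|f''|` is nonnegative. [folklore] -/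
theorem nonneg_of_abs_deriv_two_le (hM : ∀ x, |f'' x| ≤ M) : 0 ≤ M :=
  (abs_nonneg _).trans (hM 0)

/-- **Linear growth of `f'`** when `|f''| ≤ M`: `|f'(x)| ≤ |f'(0)| + M |x|` (mean value
inequality). [folklore] -/
theorem abs_deriv_le_of_abs_deriv_two_le (hf' : ∀ x, HasDerivAt f' (f'' x) x)
    (hM : ∀ x, |f'' x| ≤ M) (x : ℝ) : |f' x| ≤ |f' 0| + M * |x| := by
  have h := Convex.norm_image_sub_le_of_norm_deriv_le (𝕜 := ℝ) (f := f') (s := Set.univ)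
    (C := M) (x := 0) (y := x) (fun z _ ↦ (hf' z).differentiableAt)
    (fun z _ ↦ by rw [(hf' z).deriv]; simpa using hM z) convex_univ (Set.mem_univ _)
    (Set.mem_univ _)
  rw [Real.norm_eq_abs, Real.norm_eq_abs, sub_zero] at h
  have := abs_sub_abs_le_abs_sub (f' x) (f' 0)
  linarith

/-- **Quadratic growth of `f`** when `|f''| ≤ M`:
`|f(x)| ≤ (|f(0)| + |f'(0)|) + (|f'(0)| + 3M) x²`. [folklore] -/
theorem abs_le_of_abs_deriv_two_le (hf : ∀ x, HasDerivAt f (f' x) x)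
    (hf' : ∀ x, HasDerivAt f' (f'' x) x) (hM : ∀ x, |f'' x| ≤ M) (x : ℝ) :
    |f x| ≤ (|f 0| + |f' 0|) + (|f' 0| + 3 * M) * x ^ 2 := by
  have hM0 := nonneg_of_abs_deriv_two_le hM
  have key := abs_taylor_two_sub_le hf hf' (x := 0) (y := x) (w := 2 * M) fun z _ ↦ by
    calc |f'' z - f'' 0| ≤ |f'' z| + |f'' 0| := abs_sub _ _
      _ ≤ M + M := add_le_add (hM z) (hM 0)
      _ = 2 * M := by ring
  rw [sub_zero] at key
  have h1 : |f' 0 * x| ≤ |f' 0| * (1 + x ^ 2) := by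
    rw [abs_mul]
    exact mul_le_mul_of_nonneg_left (abs_le_one_add_sq x) (abs_nonneg _)
  have h2 : |2⁻¹ * f'' 0 * x ^ 2| ≤ M * x ^ 2 := by
    rw [abs_mul, abs_mul, abs_of_pos (by norm_num : (0 : ℝ) < 2⁻¹), abs_of_nonneg (sq_nonneg x)]
    nlinarith [hM 0, sq_nonneg x, abs_nonneg (f'' 0)]
  have h3 : |f x| ≤ |f x - f 0 - f' 0 * x - 2⁻¹ * f'' 0 * x ^ 2| + |f 0| + |f' 0 * x| +
      |2⁻¹ * f'' 0 * x ^ 2| := by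
    have e : f x = (f x - f 0 - f' 0 * x - 2⁻¹ * f'' 0 * x ^ 2) + f 0 + f' 0 * x +
        2⁻¹ * f'' 0 * x ^ 2 := by ring
    calc |f x| = |(f x - f 0 - f' 0 * x - 2⁻¹ * f'' 0 * x ^ 2) + f 0 + f' 0 * x +
          2⁻¹ * f'' 0 * x ^ 2| := by rw [← e]
      _ ≤ _ := by
        refine (abs_add_le _ _).trans (add_le_add ((abs_add_le _ _).trans (add_le_add
          ((abs_add_le _ _).trans le_rfl) le_rfl)) le_rfl)
  nlinarith [key, h1, h2, h3, sq_nonneg x]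

/-- **Two-regime Taylor remainder.** If `|f''| ≤ M` and `|f''(x) - f''(y)| ≤ η` whenever
`|x - y| ≤ δ` (`δ > 0`), then for all `x, d`,
`|f(x + d) - f(x) - f'(x) d - ½ f''(x) d²| ≤ η d² + (2M/δ²) d⁴`
(modulus `η` if `|d| ≤ δ`, crude bound `2M ≤ 2M d²/δ²` otherwise).
Revuz–Yor, *Continuous Martingales and Brownian Motion* (1999), Ch. IV, proof of Thm (3.3)
(Taylor's formula with the uniform continuity of the second derivative). [folklore] -/
theorem abs_taylor_two_sub_le_of_modulus (hf : ∀ x, HasDerivAt f (f' x) x)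
    (hf' : ∀ x, HasDerivAt f' (f'' x) x) (hM : ∀ x, |f'' x| ≤ M) {δ η : ℝ} (hδ : 0 < δ)
    (hmod : ∀ x y, |x - y| ≤ δ → |f'' x - f'' y| ≤ η) (x d : ℝ) :
    |f (x + d) - f x - f' x * d - 2⁻¹ * f'' x * d ^ 2| ≤
      η * d ^ 2 + 2 * M / δ ^ 2 * d ^ 4 := by
  have hM0 := nonneg_of_abs_deriv_two_le hM
  have hη0 : 0 ≤ η := (abs_nonneg _).trans (hmod 0 0 (by simpa using hδ.le))
  have key := abs_taylor_two_sub_le hf hf' (x := x) (y := x + d)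
    (w := if |d| ≤ δ then η else 2 * M) fun z hz ↦ by
    split_ifs with h
    · refine hmod z x ((Set.abs_sub_left_of_mem_uIcc hz).trans ?_)
      simpa using h
    · calc |f'' z - f'' x| ≤ |f'' z| + |f'' x| := abs_sub _ _
        _ ≤ M + M := add_le_add (hM z) (hM x)
        _ = 2 * M := by ring
  simp only [add_sub_cancel_left] at key
  refine key.trans ?_
  split_ifs with h
  · nlinarith [sq_nonneg d, sq_nonneg (d ^ 2), div_nonneg (mul_nonneg zero_le_two hM0) (sq_nonneg δ)]
  · push Not at h
    have hd2 : δ ^ 2 ≤ d ^ 2 := by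
      rw [← sq_abs d]
      exact pow_le_pow_left₀ hδ.le h.le 2
    have h1 : 2 * M * d ^ 2 ≤ 2 * M / δ ^ 2 * d ^ 4 := by
      rw [div_mul_eq_mul_div, le_div_iff₀ (by positivity)]
      calc 2 * M * d ^ 2 * δ ^ 2 ≤ 2 * M * d ^ 2 * d ^ 2 :=
            mul_le_mul_of_nonneg_left hd2 (by positivity)
        _ = 2 * M * d ^ 4 := by ring
    nlinarith [sq_nonneg d]

/-- The second derivative in a `HasDerivAt` chain is measurable (it is `deriv f'`). [folklore] -/
theorem measurable_deriv_two (hf' : ∀ x, HasDerivAt f' (f'' x) x) : Measurable f'' := by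
  have : f'' = deriv f' := funext fun x ↦ (hf' x).deriv.symm
  rw [this]
  exact measurable_deriv f'

end Calculus

/-! ### Integrability of `C²` functions of square-integrable random variables -/

section Integrability

variable {Ω : Type*} {m : MeasurableSpace Ω} {μ : Measure Ω} [IsFiniteMeasure μ]
  {f f' f'' : ℝ → ℝ} {M : ℝ}

/-- A continuous function of quadratic growth of an `L²` random variable is integrable.
[folklore] -/
theorem integrable_comp_of_abs_le_quad {g : ℝ → ℝ} (hg : Continuous g) {A K : ℝ}
    (hgq : ∀ x, |g x| ≤ A + K * x ^ 2) {Y : Ω → ℝ} (hY : MemLp Y 2 μ) :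
    Integrable (fun ω ↦ g (Y ω)) μ := by
  have hY2 : Integrable (fun ω ↦ A + K * Y ω ^ 2) μ :=
    (integrable_const A).add (hY.integrable_sq.const_mul K)
  refine hY2.mono (hg.comp_aestronglyMeasurable hY.1) (ae_of_all _ fun ω ↦ ?_)
  rw [Real.norm_eq_abs, Real.norm_eq_abs]
  exact (hgq _).trans (le_abs_self _)

/-- `f(Y)` is integrable for `f ∈ C²` with `|f''| ≤ M` and `Y ∈ L²`. [folklore] -/
theorem integrable_comp_of_abs_deriv_two_le (hf : ∀ x, HasDerivAt f (f' x) x)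
    (hf' : ∀ x, HasDerivAt f' (f'' x) x) (hM : ∀ x, |f'' x| ≤ M) {Y : Ω → ℝ}
    (hY : MemLp Y 2 μ) : Integrable (fun ω ↦ f (Y ω)) μ :=
  integrable_comp_of_abs_le_quad (continuous_iff_continuousAt.2 fun x ↦ (hf x).continuousAt)
    (abs_le_of_abs_deriv_two_le hf hf' hM) hY

/-- `f'(Y)` is square integrable for `|f''| ≤ M` and `Y ∈ L²` (linear growth). [folklore] -/
theorem memLp_two_deriv_comp (hf' : ∀ x, HasDerivAt f' (f'' x) x) (hM : ∀ x, |f'' x| ≤ M)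
    {Y : Ω → ℝ} (hY : MemLp Y 2 μ) : MemLp (fun ω ↦ f' (Y ω)) 2 μ := by
  have hc : Continuous f' := continuous_iff_continuousAt.2 fun x ↦ (hf' x).continuousAt
  have h1 : MemLp (fun _ : Ω ↦ |f' 0|) 2 μ := memLp_const (|f' 0|)
  have h2 : MemLp (fun ω ↦ M * ‖Y ω‖) 2 μ := hY.norm.const_mul M
  have hg : MemLp (fun ω ↦ |f' 0| + M * ‖Y ω‖) 2 μ := h1.add h2
  refine hg.of_le (hc.comp_aestronglyMeasurable hY.1) (ae_of_all _ fun ω ↦ ?_)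
  rw [Real.norm_eq_abs, Real.norm_eq_abs, Real.norm_eq_abs]
  exact (abs_deriv_le_of_abs_deriv_two_le hf' hM _).trans (le_abs_self _)

end Integrability

/-! ### One cell: increments of Brownian motion against `𝓕⁰_a`-measurable data -/

section Cell

variable {a b : ℝ≥0} {G V : (ℝ≥0 → ℝ) → ℝ} {C : ℝ}

/-- `E[G (B_b - B_a)] = 0` for `G` `𝓕⁰_a`-measurable (independence and `E[B_b - B_a] = 0`; no
integrability is needed thanks to Mathlib's junk-value conventions).
Revuz–Yor, *Continuous Martingales and Brownian Motion* (1999), Ch. II, Prop. (1.2)(i).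
[folklore] -/
theorem integral_mul_brownian_sub_eq_zero (hab : a ≤ b)
    (hG : StronglyMeasurable[RandomPlanarGeometry.brownianFiltration a] G) :
    ∫ ω, G ω * (brownian b - brownian a) ω ∂preWienerMeasure = 0 := by
  have hind := indepFun_of_measurable_brownianFiltration hab hG.measurable
  rw [hind.integral_fun_mul_eq_mul_integral
    (hG.mono (RandomPlanarGeometry.brownianFiltration.le a)).aestronglyMeasurable
    ((measurable_brownian b).sub (measurable_brownian a)).aestronglyMeasurable]
  change (∫ ω, G ω ∂preWienerMeasure) * ∫ ω, (brownian b - brownian a) ω ∂preWienerMeasure = 0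
  rw [RandomPlanarGeometry.integral_brownian_sub a b, mul_zero]

/-- `E[G (B_b - B_a)²] = (b - a) E[G]` for `G` `𝓕⁰_a`-measurable.
Revuz–Yor, *Continuous Martingales and Brownian Motion* (1999), Ch. II, Prop. (1.2)(ii).
[folklore] -/
theorem integral_mul_brownian_sub_sq (hab : a ≤ b)
    (hG : StronglyMeasurable[RandomPlanarGeometry.brownianFiltration a] G) :
    ∫ ω, G ω * (brownian b - brownian a) ω ^ 2 ∂preWienerMeasure =
      ((b : ℝ) - a) * ∫ ω, G ω ∂preWienerMeasure := by
  have hind := (indepFun_of_measurable_brownianFiltration hab hG.measurable).comp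
    measurable_id (measurable_id.pow_const 2)
  have h := hind.integral_fun_mul_eq_mul_integral
    (hG.mono (RandomPlanarGeometry.brownianFiltration.le a)).aestronglyMeasurable
    (((measurable_brownian b).sub (measurable_brownian a)).pow_const 2).aestronglyMeasurable
  simp only [Function.comp_apply, id_eq] at h
  rw [h]
  change (∫ ω, G ω ∂preWienerMeasure) * ∫ ω, (brownian b - brownian a) ω ^ 2 ∂preWienerMeasure = _
  rw [RandomPlanarGeometry.integral_brownian_sub_sq hab, mul_comm]

/-- `E[G (B_b - B_a)⁴] = 3 (b - a)² E[G]` for `G` `𝓕⁰_a`-measurable.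
Revuz–Yor, *Continuous Martingales and Brownian Motion* (1999), Ch. IV, proof of Thm (1.3).
[folklore] -/
theorem integral_mul_brownian_sub_pow_four (hab : a ≤ b)
    (hG : StronglyMeasurable[RandomPlanarGeometry.brownianFiltration a] G) :
    ∫ ω, G ω * (brownian b - brownian a) ω ^ 4 ∂preWienerMeasure =
      3 * ((b : ℝ) - a) ^ 2 * ∫ ω, G ω ∂preWienerMeasure := by
  have hind := (indepFun_of_measurable_brownianFiltration hab hG.measurable).comp
    measurable_id (measurable_id.pow_const 4)
  have h := hind.integral_fun_mul_eq_mul_integral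
    (hG.mono (RandomPlanarGeometry.brownianFiltration.le a)).aestronglyMeasurable
    (((measurable_brownian b).sub (measurable_brownian a)).pow_const 4).aestronglyMeasurable
  simp only [Function.comp_apply, id_eq] at h
  rw [h]
  change (∫ ω, G ω ∂preWienerMeasure) * ∫ ω, (brownian b - brownian a) ω ^ 4 ∂preWienerMeasure = _
  rw [integral_brownian_sub_pow_four a b, mul_comm]

/-- A bounded `𝓕⁰_a`-measurable multiple of the increment `B_b - B_a` is in `L⁴`. [folklore] -/
theorem memLp_four_mul_brownian_sub (hV : StronglyMeasurable[RandomPlanarGeometry.brownianFiltration a] V)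
    (hVC : ∀ ω, |V ω| ≤ C) :
    MemLp (fun ω ↦ V ω * (brownian b - brownian a) ω) 4 preWienerMeasure := by
  refine (memLp_brownian_sub a b (p := 4) (by norm_num)).of_le_mul (c := C)
    ((hV.mono (RandomPlanarGeometry.brownianFiltration.le a)).aestronglyMeasurable.mul
      ((measurable_brownian b).sub (measurable_brownian a)).aestronglyMeasurable)
    (ae_of_all _ fun ω ↦ ?_)
  rw [norm_mul, Real.norm_eq_abs]
  exact mul_le_mul_of_nonneg_right (hVC ω) (norm_nonneg _)

/-- A bounded `𝓕⁰_a`-measurable multiple of the increment `B_b - B_a` is in `L²`. [folklore] -/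
theorem memLp_two_mul_brownian_sub (hV : StronglyMeasurable[RandomPlanarGeometry.brownianFiltration a] V)
    (hVC : ∀ ω, |V ω| ≤ C) :
    MemLp (fun ω ↦ V ω * (brownian b - brownian a) ω) 2 preWienerMeasure :=
  haveI := RandomPlanarGeometry.isProbabilityMeasure_preWienerMeasure'
  (memLp_four_mul_brownian_sub hV hVC).mono_exponent (by norm_num)

variable {f f' f'' : ℝ → ℝ} {M : ℝ}

/-- **The one-cell Itô–Taylor estimate.** For `a ≤ b`, `Y ∈ L²` and `V` bounded, both
`𝓕⁰_a`-measurable, `D = V (B_b - B_a)`, and `f ∈ C²` with `|f''| ≤ M` and modulus `(δ, η)`: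
`|E[f(Y + D)] - E[f(Y)] - ½ (b - a) E[f''(Y) V²]| ≤ η (b - a) E[V²] + (6M/δ²) (b - a)² E[V⁴]`.
Revuz–Yor, *Continuous Martingales and Brownian Motion* (1999), Ch. IV, proof of Thm (3.3)
(one step of the Taylor expansion, conditionally Gaussian increment). [folklore] -/
theorem abs_integral_comp_add_sub_le_cell (hf : ∀ x, HasDerivAt f (f' x) x)
    (hf' : ∀ x, HasDerivAt f' (f'' x) x) (hM : ∀ x, |f'' x| ≤ M) {δ η : ℝ} (hδ : 0 < δ)
    (hmod : ∀ x y, |x - y| ≤ δ → |f'' x - f'' y| ≤ η) (hab : a ≤ b) {Y : (ℝ≥0 → ℝ) → ℝ}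
    (hY : StronglyMeasurable[RandomPlanarGeometry.brownianFiltration a] Y) (hY2 : MemLp Y 2 preWienerMeasure)
    (hV : StronglyMeasurable[RandomPlanarGeometry.brownianFiltration a] V) (hVC : ∀ ω, |V ω| ≤ C) :
    |(∫ ω, f (Y ω + V ω * (brownian b - brownian a) ω) ∂preWienerMeasure) -
        (∫ ω, f (Y ω) ∂preWienerMeasure) -
        2⁻¹ * ((b : ℝ) - a) * ∫ ω, f'' (Y ω) * V ω ^ 2 ∂preWienerMeasure| ≤
      η * ((b : ℝ) - a) * (∫ ω, V ω ^ 2 ∂preWienerMeasure) +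
        6 * M / δ ^ 2 * ((b : ℝ) - a) ^ 2 * ∫ ω, V ω ^ 4 ∂preWienerMeasure := by
  haveI := RandomPlanarGeometry.isProbabilityMeasure_preWienerMeasure'
  have hM0 := nonneg_of_abs_deriv_two_le hM
  -- notation and measurability
  set P := preWienerMeasure with hP
  set D : (ℝ≥0 → ℝ) → ℝ := fun ω ↦ V ω * (brownian b - brownian a) ω with hD
  have hfc : Continuous f := continuous_iff_continuousAt.2 fun x ↦ (hf x).continuousAt
  have hf'c : Continuous f' := continuous_iff_continuousAt.2 fun x ↦ (hf' x).continuousAt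
  have hf''m : Measurable f'' := measurable_deriv_two hf'
  have hYm : AEStronglyMeasurable Y P := (hY.mono (RandomPlanarGeometry.brownianFiltration.le a)).aestronglyMeasurable
  have hVm : AEStronglyMeasurable V P := (hV.mono (RandomPlanarGeometry.brownianFiltration.le a)).aestronglyMeasurable
  have hD4 : MemLp D 4 P := memLp_four_mul_brownian_sub hV hVC
  have hD2 : MemLp D 2 P := memLp_two_mul_brownian_sub hV hVC
  have hDm : AEStronglyMeasurable D P := hD2.1
  -- `𝓕⁰_a`-measurability of the frozen coefficients
  have hG1 : StronglyMeasurable[RandomPlanarGeometry.brownianFiltration a] fun ω ↦ f' (Y ω) * V ω :=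
    (hf'c.comp_stronglyMeasurable hY).mul hV
  have hG2 : StronglyMeasurable[RandomPlanarGeometry.brownianFiltration a] fun ω ↦ f'' (Y ω) * V ω ^ 2 :=
    (hf''m.comp hY.measurable).stronglyMeasurable.mul (hV.pow 2)
  have hG3 : StronglyMeasurable[RandomPlanarGeometry.brownianFiltration a] fun ω ↦ V ω ^ 2 := hV.pow 2
  have hG4 : StronglyMeasurable[RandomPlanarGeometry.brownianFiltration a] fun ω ↦ V ω ^ 4 := hV.pow 4
  -- integrability of the four pieces
  have hi0 : Integrable (fun ω ↦ f (Y ω)) P := integrable_comp_of_abs_deriv_two_le hf hf' hM hY2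
  have hi1 : Integrable (fun ω ↦ f (Y ω + D ω)) P :=
    integrable_comp_of_abs_deriv_two_le hf hf' hM (hY2.add hD2)
  have hi2 : Integrable (fun ω ↦ f' (Y ω) * D ω) P :=
    (memLp_two_deriv_comp hf' hM hY2).integrable_mul hD2
  have hi3 : Integrable (fun ω ↦ f'' (Y ω) * D ω ^ 2) P := by
    refine (hD2.integrable_sq).bdd_mul (c := M)
      (hf''m.comp_aemeasurable hYm.aemeasurable).aestronglyMeasurable
      (ae_of_all _ fun ω ↦ ?_)
    rw [Real.norm_eq_abs]
    exact hM _
  have hiD2 : Integrable (fun ω ↦ D ω ^ 2) P := hD2.integrable_sq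
  have hiD4 : Integrable (fun ω ↦ D ω ^ 4) P := by
    have h := hD4.integrable_norm_rpow (by norm_num) (by norm_num)
    refine h.congr (ae_of_all _ fun ω ↦ ?_)
    have h4 : ((4 : ℝ≥0∞)).toReal = ((4 : ℕ) : ℝ) := by norm_num
    dsimp only
    rw [h4, Real.rpow_natCast, Real.norm_eq_abs, ← abs_pow, abs_of_nonneg (by positivity)]
  -- the remainder and its bound
  set R : (ℝ≥0 → ℝ) → ℝ := fun ω ↦
    f (Y ω + D ω) - f (Y ω) - f' (Y ω) * D ω - 2⁻¹ * f'' (Y ω) * D ω ^ 2 with hR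
  have hi3' : Integrable (fun ω ↦ 2⁻¹ * (f'' (Y ω) * D ω ^ 2)) P := hi3.const_mul 2⁻¹
  have hkey : ∀ ω, f (Y ω + D ω) =
      f (Y ω) + f' (Y ω) * D ω + 2⁻¹ * (f'' (Y ω) * D ω ^ 2) + R ω := fun ω ↦ by
    simp only [hR]; ring
  have hRi : Integrable R P := by
    have h : Integrable (fun ω ↦ f (Y ω + D ω) - f (Y ω) - f' (Y ω) * D ω -
        2⁻¹ * (f'' (Y ω) * D ω ^ 2)) P := ((hi1.sub hi0).sub hi2).sub hi3'
    refine h.congr (ae_of_all _ fun ω ↦ ?_)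
    simp only [hR]; ring
  have hRb : ∀ ω, |R ω| ≤ η * D ω ^ 2 + 2 * M / δ ^ 2 * D ω ^ 4 := fun ω ↦
    abs_taylor_two_sub_le_of_modulus hf hf' hM hδ hmod (Y ω) (D ω)
  -- expectations of the main terms
  have e1 : ∫ ω, f' (Y ω) * D ω ∂P = 0 := by
    have : ∀ ω, f' (Y ω) * D ω = (f' (Y ω) * V ω) * (brownian b - brownian a) ω :=
      fun ω ↦ by simp only [hD]; ring
    simp_rw [this]
    exact integral_mul_brownian_sub_eq_zero hab hG1
  have e2 : ∫ ω, f'' (Y ω) * D ω ^ 2 ∂P = ((b : ℝ) - a) * ∫ ω, f'' (Y ω) * V ω ^ 2 ∂P := by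
    have : ∀ ω, f'' (Y ω) * D ω ^ 2 = (f'' (Y ω) * V ω ^ 2) * (brownian b - brownian a) ω ^ 2 :=
      fun ω ↦ by simp only [hD]; ring
    simp_rw [this]
    exact integral_mul_brownian_sub_sq hab hG2
  have e3 : ∫ ω, D ω ^ 2 ∂P = ((b : ℝ) - a) * ∫ ω, V ω ^ 2 ∂P := by
    have : ∀ ω, D ω ^ 2 = V ω ^ 2 * (brownian b - brownian a) ω ^ 2 := fun ω ↦ by
      simp only [hD]; ring
    simp_rw [this]
    exact integral_mul_brownian_sub_sq hab hG3
  have e4 : ∫ ω, D ω ^ 4 ∂P = 3 * ((b : ℝ) - a) ^ 2 * ∫ ω, V ω ^ 4 ∂P := by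
    have : ∀ ω, D ω ^ 4 = V ω ^ 4 * (brownian b - brownian a) ω ^ 4 := fun ω ↦ by
      simp only [hD]; ring
    simp_rw [this]
    exact integral_mul_brownian_sub_pow_four hab hG4
  -- the decomposition of the difference of expectations
  have hsum : ∫ ω, f (Y ω + D ω) ∂P = (∫ ω, f (Y ω) ∂P) + (∫ ω, f' (Y ω) * D ω ∂P) +
      2⁻¹ * (∫ ω, f'' (Y ω) * D ω ^ 2 ∂P) + ∫ ω, R ω ∂P := by
    have h01 : Integrable (fun ω ↦ f (Y ω) + f' (Y ω) * D ω) P := hi0.add hi2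
    have h012 : Integrable (fun ω ↦ f (Y ω) + f' (Y ω) * D ω + 2⁻¹ * (f'' (Y ω) * D ω ^ 2)) P :=
      h01.add hi3'
    rw [integral_congr_ae (ae_of_all _ hkey), integral_add h012 hRi, integral_add h01 hi3',
      integral_add hi0 hi2, integral_const_mul]
  have hdec : (∫ ω, f (Y ω + D ω) ∂P) - (∫ ω, f (Y ω) ∂P) -
      2⁻¹ * ((b : ℝ) - a) * ∫ ω, f'' (Y ω) * V ω ^ 2 ∂P = ∫ ω, R ω ∂P := by
    rw [hsum, e1, e2]
    ring
  rw [hdec]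
  -- bound the remainder
  calc |∫ ω, R ω ∂P| ≤ ∫ ω, |R ω| ∂P := abs_integral_le_integral_abs
    _ ≤ ∫ ω, (η * D ω ^ 2 + 2 * M / δ ^ 2 * D ω ^ 4) ∂P :=
        integral_mono hRi.abs ((hiD2.const_mul η).add (hiD4.const_mul _)) hRb
    _ = η * (((b : ℝ) - a) * ∫ ω, V ω ^ 2 ∂P) +
          2 * M / δ ^ 2 * (3 * ((b : ℝ) - a) ^ 2 * ∫ ω, V ω ^ 4 ∂P) := by
        rw [integral_add (hiD2.const_mul η) (hiD4.const_mul _), integral_const_mul,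
          integral_const_mul, e3, e4]
    _ = _ := by ring

end Cell

/-! ### The elementary integral along its own capped partition -/

namespace SimpleProcess

variable {Ω : Type*} {m : MeasurableSpace Ω} {𝓕 : Filtration ℝ≥0 m}

/-- Before the first partition time the elementary integral vanishes. [folklore] -/
theorem integral_apply_of_le_time_zero (H : SimpleProcess m 𝓕) (B : ℝ≥0 → Ω → ℝ) {r : ℝ≥0}
    (hr : r ≤ H.time 0) (ω : Ω) : H.integral B r ω = 0 := by
  rw [integral_apply_eq_sum_summand]
  refine sum_eq_zero fun i hi ↦ ?_
  have hi' : i + 1 < H.times.length := by have := mem_range.1 hi; omega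
  rw [H.summand_eq_zero_of_le B hi' (hr.trans (H.time_mono (Nat.zero_le i) (by omega)))]
  rfl

/-- Capping the time at the last partition time does not change the elementary integral.
[folklore] -/
theorem integral_min_time_last (H : SimpleProcess m 𝓕) (B : ℝ≥0 → Ω → ℝ) (r : ℝ≥0) (ω : Ω) :
    H.integral B (min r (H.time (H.times.length - 1))) ω = H.integral B r ω := by
  rw [integral_apply_eq_sum_summand, integral_apply_eq_sum_summand]
  refine sum_congr rfl fun i hi ↦ ?_
  have hi' : i + 1 < H.times.length := by have := mem_range.1 hi; omega
  have h1 : H.time (i + 1) ≤ H.time (H.times.length - 1) := H.time_mono (by omega) (by omega)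
  have h0 : H.time i ≤ H.time (H.times.length - 1) := H.time_mono (by omega) (by omega)
  simp only [summand_apply]
  rw [min_assoc, min_eq_right h1, min_assoc, min_eq_right h0]

/-- The capped increments `T ∧ tᵢ₊₁ - T ∧ tᵢ` are nonnegative. [folklore] -/
theorem sub_min_time_nonneg (H : SimpleProcess m 𝓕) (T : ℝ≥0) {i : ℕ}
    (hi : i + 1 < H.times.length) :
    0 ≤ ((min T (H.time (i + 1)) : ℝ≥0) : ℝ) - (min T (H.time i) : ℝ≥0) :=
  sub_nonneg.2 (NNReal.coe_le_coe.2 (min_le_min_left T (H.time_mono (Nat.le_succ i) hi)))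

/-- The capped increments telescope: `∑ᵢ (T ∧ tᵢ₊₁ - T ∧ tᵢ) ≤ T`. [folklore] -/
theorem sum_sub_min_time_le (H : SimpleProcess m 𝓕) (T : ℝ≥0) :
    ∑ i ∈ range (H.times.length - 1),
      (((min T (H.time (i + 1)) : ℝ≥0) : ℝ) - (min T (H.time i) : ℝ≥0)) ≤ T := by
  rw [Finset.sum_range_sub (fun i ↦ ((min T (H.time i) : ℝ≥0) : ℝ))]
  have h1 : ((min T (H.time (H.times.length - 1)) : ℝ≥0) : ℝ) ≤ T :=
    NNReal.coe_le_coe.2 (min_le_left _ _)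
  have h2 : (0 : ℝ) ≤ ((min T (H.time 0) : ℝ≥0) : ℝ) := NNReal.coe_nonneg _
  linarith

/-- Each capped increment is bounded by the corresponding partition increment. [folklore] -/
theorem sub_min_time_le (H : SimpleProcess m 𝓕) (T : ℝ≥0) {i : ℕ}
    (hi : i + 1 < H.times.length) :
    ((min T (H.time (i + 1)) : ℝ≥0) : ℝ) - (min T (H.time i) : ℝ≥0) ≤
      (H.time (i + 1) : ℝ) - H.time i := by
  have hmono := H.time_mono (Nat.le_succ i) hi
  rcases le_total T (H.time i) with h | h
  · rw [min_eq_left h, min_eq_left (h.trans hmono), sub_self]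
    exact sub_nonneg.2 (NNReal.coe_le_coe.2 hmono)
  · rw [min_eq_right h]
    have : ((min T (H.time (i + 1)) : ℝ≥0) : ℝ) ≤ H.time (i + 1) :=
      NNReal.coe_le_coe.2 (min_le_right _ _)
    linarith

end SimpleProcess

/-! ### The Itô–Taylor estimate for elementary integrals -/

section Main

variable (H : SimpleProcess (inferInstance : MeasurableSpace (ℝ≥0 → ℝ)) RandomPlanarGeometry.brownianFiltration)
  {f f' f'' : ℝ → ℝ} {M : ℝ}

/-- **One capped cell of the elementary integral.** With `aᵢ = T ∧ tᵢ`, `bᵢ = T ∧ tᵢ₊₁`,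
`X = H · B`:
`|E[f(X_{bᵢ})] - E[f(X_{aᵢ})] - ½ (bᵢ - aᵢ) E[f''(X_{aᵢ}) Hᵢ²]| ≤ η (bᵢ - aᵢ) E[Hᵢ²] + (6M/δ²) (bᵢ - aᵢ)² E[Hᵢ⁴]`.
Revuz–Yor, *Continuous Martingales and Brownian Motion* (1999), Ch. IV, proof of Thm (3.3).
[folklore] -/
theorem SimpleProcess.abs_integral_comp_integral_cell_le_brownian (hf : ∀ x, HasDerivAt f (f' x) x)
    (hf' : ∀ x, HasDerivAt f' (f'' x) x) (hM : ∀ x, |f'' x| ≤ M) {δ η : ℝ} (hδ : 0 < δ)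
    (hmod : ∀ x y, |x - y| ≤ δ → |f'' x - f'' y| ≤ η) (T : ℝ≥0) {i : ℕ}
    (hi : i + 1 < H.times.length) :
    |(∫ ω, f (H.integral brownian (min T (H.time (i + 1))) ω) ∂preWienerMeasure) -
        (∫ ω, f (H.integral brownian (min T (H.time i)) ω) ∂preWienerMeasure) -
        2⁻¹ * (((min T (H.time (i + 1)) : ℝ≥0) : ℝ) - (min T (H.time i) : ℝ≥0)) *
          ∫ ω, f'' (H.integral brownian (min T (H.time i)) ω) * H.value i ω ^ 2
            ∂preWienerMeasure| ≤
      η * (((min T (H.time (i + 1)) : ℝ≥0) : ℝ) - (min T (H.time i) : ℝ≥0)) *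
          (∫ ω, H.value i ω ^ 2 ∂preWienerMeasure) +
        6 * M / δ ^ 2 * (((min T (H.time (i + 1)) : ℝ≥0) : ℝ) - (min T (H.time i) : ℝ≥0)) ^ 2 *
          ∫ ω, H.value i ω ^ 4 ∂preWienerMeasure := by
  obtain ⟨C, hC⟩ := H.bounded
  by_cases hT : H.time i ≤ T
  · -- genuine cell: `aᵢ = tᵢ`
    have ha : min T (H.time i) = H.time i := min_eq_right hT
    have hab : H.time i ≤ min T (H.time (i + 1)) :=
      le_min hT (H.time_mono (Nat.le_succ i) hi)
    have hincr : ∀ ω, H.integral brownian (min T (H.time (i + 1))) ω =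
        H.integral brownian (min T (H.time i)) ω +
          H.value i ω * (brownian (min T (H.time (i + 1))) - brownian (min T (H.time i))) ω := by
      intro ω
      have := H.integral_min_succ_sub brownian hi T ω
      rw [Pi.sub_apply]
      linarith
    simp_rw [hincr, ha]
    exact abs_integral_comp_add_sub_le_cell hf hf' hM hδ hmod hab
      ((martingale_integral_brownian H).stronglyAdapted (H.time i))
      (memLp_two_integral_brownian H (H.time i)) (H.stronglyMeasurable_value (by omega)) (hC i)
  · -- degenerate cell: `aᵢ = bᵢ = T`
    push Not at hT
    have ha : min T (H.time i) = T := min_eq_left hT.le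
    have hb : min T (H.time (i + 1)) = T :=
      min_eq_left (hT.le.trans (H.time_mono (Nat.le_succ i) hi))
    rw [ha, hb]
    simp

/-- **Itô–Taylor estimate in expectation for elementary integrals** (`X = H · B`, `B` the
canonical Brownian motion, raw filtration): for `f ∈ C²(ℝ)` with `|f''| ≤ M` and
`|x - y| ≤ δ ⇒ |f''(x) - f''(y)| ≤ η`, and any `T`,
`|E[f(X_T)] - f(0) - ½ ∑ᵢ (Δᵢt) E[f''(X_{T ∧ tᵢ}) Hᵢ²]| ≤ ∑ᵢ (η (Δᵢt) E[Hᵢ²] + (6M/δ²) (Δᵢt)² E[Hᵢ⁴])`,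
`Δᵢt = T ∧ tᵢ₊₁ - T ∧ tᵢ` (sum over the cells of `H`). This is the expectation form of Itô's
formula `E[f(X_T)] = f(0) + ½ E∫₀ᵀ f''(X_s) H_s² ds` along the subdivision of `H`, with the
Taylor error made explicit.
Revuz–Yor, *Continuous Martingales and Brownian Motion* (1999), Ch. IV, Thm (3.3) (proof:
Taylor expansion of order two along subdivisions) and Remark 1 after it. [folklore] -/
theorem SimpleProcess.ito_taylor_estimate_brownian (hf : ∀ x, HasDerivAt f (f' x) x)
    (hf' : ∀ x, HasDerivAt f' (f'' x) x) (hM : ∀ x, |f'' x| ≤ M) {δ η : ℝ} (hδ : 0 < δ)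
    (hmod : ∀ x y, |x - y| ≤ δ → |f'' x - f'' y| ≤ η) (T : ℝ≥0) :
    |(∫ ω, f (H.integral brownian T ω) ∂preWienerMeasure) - f 0 -
        2⁻¹ * ∑ i ∈ range (H.times.length - 1),
          (((min T (H.time (i + 1)) : ℝ≥0) : ℝ) - (min T (H.time i) : ℝ≥0)) *
            ∫ ω, f'' (H.integral brownian (min T (H.time i)) ω) * H.value i ω ^ 2
              ∂preWienerMeasure| ≤
      ∑ i ∈ range (H.times.length - 1),
        (η * (((min T (H.time (i + 1)) : ℝ≥0) : ℝ) - (min T (H.time i) : ℝ≥0)) *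
            (∫ ω, H.value i ω ^ 2 ∂preWienerMeasure) +
          6 * M / δ ^ 2 * (((min T (H.time (i + 1)) : ℝ≥0) : ℝ) - (min T (H.time i) : ℝ≥0)) ^ 2 *
            ∫ ω, H.value i ω ^ 4 ∂preWienerMeasure) := by
  haveI := RandomPlanarGeometry.isProbabilityMeasure_preWienerMeasure'
  set g : ℕ → ℝ := fun i ↦ ∫ ω, f (H.integral brownian (min T (H.time i)) ω) ∂preWienerMeasure
    with hg
  -- telescoping: `E[f(X_T)] - f(0) = ∑ᵢ (g (i+1) - g i)`
  have h0 : g 0 = f 0 := by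
    simp only [hg]
    simp_rw [H.integral_apply_of_le_time_zero brownian (min_le_right T (H.time 0))]
    simp
  have hlast : g (H.times.length - 1) = ∫ ω, f (H.integral brownian T ω) ∂preWienerMeasure := by
    simp only [hg]
    simp_rw [H.integral_min_time_last brownian T]
  have htel : (∫ ω, f (H.integral brownian T ω) ∂preWienerMeasure) - f 0 =
      ∑ i ∈ range (H.times.length - 1), (g (i + 1) - g i) := by
    rw [Finset.sum_range_sub, hlast, h0]
  rw [htel, mul_sum, ← sum_sub_distrib]
  refine (abs_sum_le_sum_abs _ _).trans (sum_le_sum fun i hi ↦ ?_)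
  have hi' : i + 1 < H.times.length := by have := mem_range.1 hi; omega
  have := H.abs_integral_comp_integral_cell_le_brownian hf hf' hM hδ hmod T hi'
  simp only [hg]
  rw [← mul_assoc]
  exact this

end Main

end Literature.Probability.Process
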